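import Literature.MathematicalPhysics.QuantumFieldTheory.PseudofermionIntegral
import HarnessLib

/-!
# Variance and existence condition of the Gaussian stochastic determinant estimator
# (Finkenrath–Knechtli–Leder), I: the integral, the second moment, the variance

Topic `MathematicalPhysics/QuantumFieldTheory`, sequel to `PseudofermionIntegral.lean` (which has
the MEAN of the estimator, Knechtli–Wolff (4.5) `Pseudofermion.stochasticRatio_mean`); continued in
`StochasticDeterminantFactorisation.lean` (spectral readings, the `A = M†M` form, §2.3).  PUBLISHED
RESULTS with our proofs — no named fact is introduced (D-0026).  Wanted by the cell pub-lqcd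
(venture `LatticeQCDFlow`, HOME/R2-SCOPE.md §3 E2 D1/D2 and N2 (determinant ratios / reweighting
factors estimated with Gaussian noise), §4 cost classes C-pf / C-PM ("the single-draw noise `C` is
the lever, i.e. preconditioning / Hasenbusch factorisation"), §2 P4 ("as the variance of the
stochastic determinant estimator increases"); FANOUT row 38).

## The printed statements (Finkenrath–Knechtli–Leder, Nucl. Phys. B 877 (2013) 441, §2.1 and
## App. A; Leder–Finkenrath–Knechtli, PoS LATTICE2013 035, §2–§3)

With `D[η] = ∏ᵢ dRe(ηᵢ) dIm(ηᵢ)/π` on `ℂⁿ` (so `∫D[η] e^{−η†η} = 1`) and `A ∈ ℂ^{n×n}`: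

* (2.1) `1/det A = ∫ D[η] e^{−η†Aη}` if `λ(A + A†) > 0`; "The condition `λ(A+A†) > 0` is the
  necessary and sufficient condition for the absolute convergence of the integral"; App. A: "if `A`
  is Hermitian the condition `λ(A+A†) > 0` is equivalent to `A` being positive definite".
* (2.2) with Gaussian noise `p(η) = e^{−η†η}`: `1/det A = ⟨e^{−η†Aη}/p(η)⟩_p`, i.e. the single-noise
  estimate is `W_A(η) = e^{−η†(A−I)η}`.
* (2.3) "The variance of this estimator is given by
  `σ_η² = ⟨e^{−η†(A+A†)η}/p(η)²⟩_p − ⟨e^{−η†Aη}/p(η)⟩_p ⟨e^{−η†A†η}/p(η)⟩_p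
       = 1/det(A + A† − I) − 1/det(AA†)`."
* (2.4) "The first integral in Eq. (2.3) exists if
  `λ(A + A† − I) > 0 ⟺ λ(A + A†) > 1 ⟹ Re(λ(A)) > 0.5`"; PoS §3: "Therefore the variance exists
  iff `σ(A + A†) > 1`".
* (2.5) for `A = I + εB`: "`σ_η²/|det A|⁻² = det(I + ε² BB†/(I + ε(B + B†))) − 1 = ε² Tr(BB†) + O(ε³)`".

## What is proved here (Lebesgue measure `volume` on `ι → ℂ`, i.e. WITHOUT the `1/πⁿ`; quadratic
## forms through `Re (star η ⬝ᵥ (A *ᵥ η)) = Re(η†Aη)`)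

* `integrable_exp_neg_quadForm_iff` — for HERMITIAN `B`: `η ↦ e^{−Re(η†Bη)}` is integrable on `ℂⁿ`
  iff `B` is positive definite ((2.1)'s existence clause, Hermitian case; the value `πⁿ/det B` is the
  tree's `Literature.Analysis.SpecialFunctions.complexGaussianIntegral_posDef_holds`).  Proof as in
  App. A / PoS (2.3) for normal matrices: unitary diagonalisation `η = Uz` (`|det U|² = 1`), the
  integral factorises into `∏ᵢ ∫_ℂ e^{−λᵢ|w|²} dw`, and a factor with `λᵢ ≤ 0` diverges (its
  integrand is `≥ 1` on `ℂ`, which has infinite Lebesgue measure).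
* `gaussian_mul_sq_norm_detInvEst` — for EVERY complex `A`: `p(η) |W_A(η)|² = e^{−Re η†(A+A†−I)η}`,
  the integrand of the first term of (2.3); hence, since `A + A† − I` is Hermitian for every `A`,
  `integrable_gaussian_mul_sq_norm_detInvEst_iff` — **(2.4) for every complex `A`**: the second
  moment `⟨|W_A|²⟩_p` is an absolutely convergent integral iff `A + A† − I` is positive definite —
  and `integral_gaussian_mul_sq_norm_detInvEst` — **(2.3), first term**: it then equals
  `1/det(A + A† − I)`;
* `half_lt_re_eigenvalue` — (2.4)'s "`⟹ Re λ(A) > 1/2`" for every eigenvalue of `A` (App. A's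
  field-of-values argument at an eigenvector);
* Hermitian positive-definite `A` (there the mean `⟨W_A⟩ = 1/det A` is the tree's Gaussian integral;
  the general non-normal case of (2.1)–(2.3) and (2.5) is the sequel
  `StochasticDeterminantNonNormal.lean`):
  `integral_gaussian_mul_detInvEst` ((2.2): `⟨W_A⟩_p = 1/det A`),
  `variance_detInvEst` (**(2.3)**: `σ_η² = 1/det(A + A† − I) − 1/det(AA†)`), `relVariance_detInvEst`
  ((2.5)'s exact first equality `σ_η²/(det A)⁻² = det(I + (A−I)(A−I)†(A+A†−I)⁻¹) − 1`), and
  `det_mul_det_conjTranspose_div` — the matrix identity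
  `det A·det A†/det(A+A†−I) = det(I + (A−I)(A−I)†(A+A†−I)⁻¹)` behind (2.5), for EVERY `A` (from
  `AA† = (A + A† − I) + (A − I)(A − I)†`).  The small-`ε` expansion `ε² Tr(BB†) + O(ε³)` is not
  formalised.

## References
* [FinkenrathKnechtliLeder2013OneFlavor] J. Finkenrath, F. Knechtli, B. Leder, One flavor mass
  reweighting in lattice QCD, Nucl. Phys. B 877 (2013) 441–456, arXiv:1306.3962, §2.1 (2.1)–(2.5),
  App. A.
* [LederFinkenrathKnechtli2014] B. Leder, J. Finkenrath, F. Knechtli, One flavor mass reweighting: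
  foundations, PoS(LATTICE 2013) 035, arXiv:1401.1079, §2 (2.1)–(2.3), §3 (3.1)–(3.2).
* [KnechtliWolff2003] F. Knechtli, U. Wolff, Nucl. Phys. B 663 (2003) 3, §4.1 (4.5).
* [AltlandSimons2010] A. Altland, B. D. Simons, Condensed Matter Field Theory, CUP 2010, §3.2 (3.17).
-/

namespace Literature.MathematicalPhysics.QuantumFieldTheory.StochasticDeterminant

open MeasureTheory Matrix Literature.Analysis.SpecialFunctions
open scoped BigOperators ComplexOrder ComplexConjugate

variable {ι : Type} [Fintype ι] [DecidableEq ι]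

/-! ## Quadratic-form helpers -/

omit [DecidableEq ι] in
/-- `Re(η†η) = Σᵢ |ηᵢ|²`. [folklore] -/
private theorem re_star_dotProduct_self (η : ι → ℂ) :
    (star η ⬝ᵥ η).re = ∑ i, ‖η i‖ ^ 2 := by
  simp only [dotProduct, Pi.star_apply, Complex.star_def, Complex.re_sum]
  refine Finset.sum_congr rfl fun i _ => ?_
  rw [Complex.conj_mul']
  norm_cast

omit [DecidableEq ι] in
/-- `Im(η†η) = 0`. [folklore] -/
private theorem im_star_dotProduct_self (η : ι → ℂ) : (star η ⬝ᵥ η).im = 0 := by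
  simp only [dotProduct, Pi.star_apply, Complex.star_def, Complex.im_sum]
  refine Finset.sum_eq_zero fun i _ => ?_
  rw [Complex.conj_mul', ← Complex.ofReal_pow, Complex.ofReal_im]

/-- `Re (z† diag(d) z) = Σᵢ dᵢ |zᵢ|²` for real `d`. [folklore] -/
private theorem re_star_dotProduct_diagonal_mulVec (d : ι → ℝ) (z : ι → ℂ) :
    (star z ⬝ᵥ (diagonal (fun i => (d i : ℂ)) *ᵥ z)).re = ∑ i, d i * ‖z i‖ ^ 2 := by
  simp only [dotProduct, mulVec_diagonal, Pi.star_apply, Complex.star_def, Complex.re_sum]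
  refine Finset.sum_congr rfl fun i _ => ?_
  rw [mul_left_comm, Complex.conj_mul']
  norm_cast

omit [DecidableEq ι] in
/-- `η†A†η = (η†Aη)^*`, hence `Re(η†A†η) = Re(η†Aη)`. [folklore] -/
private theorem re_star_dotProduct_conjTranspose_mulVec (A : Matrix ι ι ℂ) (η : ι → ℂ) :
    (star η ⬝ᵥ (Aᴴ *ᵥ η)).re = (star η ⬝ᵥ (A *ᵥ η)).re := by
  have h : star η ⬝ᵥ (Aᴴ *ᵥ η) = star (star η ⬝ᵥ (A *ᵥ η)) := by
    rw [star_dotProduct, star_mulVec, conjTranspose_conjTranspose, ← dotProduct_mulVec]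
  rw [h, Complex.star_def, Complex.conj_re]

omit [DecidableEq ι] in
/-- `Re η†(A + B)η = Re η†Aη + Re η†Bη`. [folklore] -/
private theorem re_quadForm_add (A B : Matrix ι ι ℂ) (η : ι → ℂ) :
    (star η ⬝ᵥ ((A + B) *ᵥ η)).re = (star η ⬝ᵥ (A *ᵥ η)).re + (star η ⬝ᵥ (B *ᵥ η)).re := by
  rw [add_mulVec, dotProduct_add, Complex.add_re]

omit [DecidableEq ι] in
/-- `Re η†(A − B)η = Re η†Aη − Re η†Bη`. [folklore] -/
private theorem re_quadForm_sub (A B : Matrix ι ι ℂ) (η : ι → ℂ) :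
    (star η ⬝ᵥ ((A - B) *ᵥ η)).re = (star η ⬝ᵥ (A *ᵥ η)).re - (star η ⬝ᵥ (B *ᵥ η)).re := by
  rw [sub_mulVec, dotProduct_sub, Complex.sub_re]

/-- `Re η†(A − I)η = Re η†Aη − Σᵢ|ηᵢ|²`. [folklore] -/
private theorem re_quadForm_sub_one (A : Matrix ι ι ℂ) (η : ι → ℂ) :
    (star η ⬝ᵥ ((A - 1) *ᵥ η)).re = (star η ⬝ᵥ (A *ᵥ η)).re - ∑ i, ‖η i‖ ^ 2 := by
  rw [re_quadForm_sub, one_mulVec, re_star_dotProduct_self]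

/-- `Re η†(A + A† − I)η = 2 Re η†Aη − Σᵢ|ηᵢ|²`. [folklore] -/
private theorem re_quadForm_add_conjTranspose_sub_one (A : Matrix ι ι ℂ) (η : ι → ℂ) :
    (star η ⬝ᵥ ((A + Aᴴ - 1) *ᵥ η)).re = 2 * (star η ⬝ᵥ (A *ᵥ η)).re - ∑ i, ‖η i‖ ^ 2 := by
  rw [re_quadForm_sub_one, re_quadForm_add, re_star_dotProduct_conjTranspose_mulVec]
  ring

/-! ## The Hermitian Gaussian integral: absolute convergence iff positive definite -/

variable {B : Matrix ι ι ℂ}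

/-- `Uᴴ B U = diag(λᵢ)` for the eigenvector unitary `U` of a Hermitian `B` (Mathlib's spectral
theorem, unfolded). [folklore] -/
private theorem conjTranspose_mul_mul_eigenvectorUnitary (hB : B.IsHermitian) :
    (hB.eigenvectorUnitary : Matrix ι ι ℂ)ᴴ * B * (hB.eigenvectorUnitary : Matrix ι ι ℂ) =
      diagonal (fun i => (hB.eigenvalues i : ℂ)) := by
  have h := hB.conjStarAlgAut_star_eigenvectorUnitary
  rw [Unitary.conjStarAlgAut_apply, Unitary.coe_star, star_star, star_eq_conjTranspose] at h
  exact h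

/-- `|det U|² = 1` for the eigenvector unitary. [folklore] -/
private theorem normSq_det_eigenvectorUnitary (hB : B.IsHermitian) :
    Complex.normSq (hB.eigenvectorUnitary : Matrix ι ι ℂ).det = 1 := by
  have h1 := congrArg Matrix.det (Unitary.coe_star_mul_self hB.eigenvectorUnitary)
  rw [det_mul, star_eq_conjTranspose, det_conjTranspose, det_one, Complex.star_def] at h1
  have h2 : ((Complex.normSq (hB.eigenvectorUnitary : Matrix ι ι ℂ).det : ℝ) : ℂ) = 1 := by
    rw [Complex.normSq_eq_conj_mul_self]; exact h1
  exact_mod_cast h2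

/-- `det U ≠ 0` for the eigenvector unitary. [folklore] -/
private theorem det_eigenvectorUnitary_ne_zero (hB : B.IsHermitian) :
    (hB.eigenvectorUnitary : Matrix ι ι ℂ).det ≠ 0 := by
  intro h
  have := normSq_det_eigenvectorUnitary hB
  rw [h, map_zero] at this
  exact zero_ne_one this

/-- The quadratic form in eigen-coordinates: `Re((Uz)† B (Uz)) = Σᵢ λᵢ |zᵢ|²`. [folklore] -/
private theorem re_quadForm_eigenvectorUnitary_mulVec (hB : B.IsHermitian) (z : ι → ℂ) :
    (star ((hB.eigenvectorUnitary : Matrix ι ι ℂ) *ᵥ z) ⬝ᵥ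
        (B *ᵥ ((hB.eigenvectorUnitary : Matrix ι ι ℂ) *ᵥ z))).re =
      ∑ i, hB.eigenvalues i * ‖z i‖ ^ 2 := by
  set U := (hB.eigenvectorUnitary : Matrix ι ι ℂ) with hU
  have h : star (U *ᵥ z) ⬝ᵥ (B *ᵥ (U *ᵥ z)) = star z ⬝ᵥ ((Uᴴ * B * U) *ᵥ z) := by
    rw [star_mulVec, ← dotProduct_mulVec, ← mulVec_mulVec, ← mulVec_mulVec]
  rw [h, hU, conjTranspose_mul_mul_eigenvectorUnitary hB, re_star_dotProduct_diagonal_mulVec]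

/-- The Lebesgue measure of `ℂ` is infinite. [folklore] -/
private theorem volume_univ_complex : (volume : Measure ℂ) Set.univ = ⊤ := by
  have h := Complex.volume_preserving_equiv_real_prod.measure_preimage
    (MeasurableSet.univ : MeasurableSet (Set.univ : Set (ℝ × ℝ))).nullMeasurableSet
  rw [Set.preimage_univ] at h
  rw [h, Measure.volume_eq_prod, ← Set.univ_prod_univ, Measure.prod_prod, Real.volume_univ,
    ENNReal.top_mul_top]

/-- `w ↦ e^{−d|w|²}` is not integrable on `ℂ` when `d ≤ 0` (its values are `≥ 1`). [folklore] -/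
private theorem not_integrable_exp_neg_mul_sq_norm {d : ℝ} (hd : d ≤ 0) :
    ¬ Integrable (fun w : ℂ => Real.exp (-(d * ‖w‖ ^ 2))) := by
  intro h
  have h1 : Integrable (fun _ : ℂ => (1 : ℝ)) (volume : Measure ℂ) := by
    refine h.mono' aestronglyMeasurable_const (Filter.Eventually.of_forall fun w => ?_)
    rw [norm_one]
    exact Real.one_le_exp (by nlinarith [sq_nonneg ‖w‖])
  rcases integrable_const_iff.mp h1 with h0 | hfin
  · exact one_ne_zero h0
  · have := measure_lt_top (volume : Measure ℂ) Set.univ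
    rw [volume_univ_complex] at this
    exact lt_irrefl _ this

/-- **Factorisation in eigen-coordinates**: `∫ e^{−Re(η†Bη)} dη = ∏ᵢ ∫_ℂ e^{−λᵢ|w|²} dw` for Hermitian
`B` (both sides Bochner integrals; the substitution `η = Uz` has unit Jacobian). [folklore] -/
private theorem integral_exp_neg_quadForm_eq_prod (hB : B.IsHermitian) :
    ∫ η : ι → ℂ, Real.exp (-(star η ⬝ᵥ (B *ᵥ η)).re) =
      ∏ i, ∫ w : ℂ, Real.exp (-(hB.eigenvalues i * ‖w‖ ^ 2)) := by
  set U := (hB.eigenvectorUnitary : Matrix ι ι ℂ) with hU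
  have key := integral_comp_mulVec U (det_eigenvectorUnitary_ne_zero hB)
    (fun η => Real.exp (-(star η ⬝ᵥ (B *ᵥ η)).re))
  rw [hU, normSq_det_eigenvectorUnitary hB, inv_one, one_mul] at key
  rw [← key]
  simp_rw [re_quadForm_eigenvectorUnitary_mulVec hB]
  have h : ∀ z : ι → ℂ, Real.exp (-(∑ i, hB.eigenvalues i * ‖z i‖ ^ 2)) =
      ∏ i, Real.exp (-(hB.eigenvalues i * ‖z i‖ ^ 2)) := by
    intro z
    rw [← Finset.sum_neg_distrib, Real.exp_sum]
  simp_rw [h]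
  exact integral_fintype_prod_volume_eq_prod
    (fun i (w : ℂ) => Real.exp (-(hB.eigenvalues i * ‖w‖ ^ 2)))

/-- **Absolute convergence of the Gaussian determinant integral iff positive definite (Hermitian
case).**  For a Hermitian complex matrix `B`, `η ↦ e^{−Re(η†Bη)} = |e^{−η†Bη}|` is integrable on `ℂⁿ`
if and only if `B` is positive definite — Finkenrath–Knechtli–Leder's "`λ(A + A†) > 0` is the
necessary and sufficient condition for the absolute convergence", which "if `A` is Hermitian … is
equivalent to `A` being positive definite"; the value is then `πⁿ/det B` (tree:
`complexGaussianIntegral_posDef_holds`).  Proof as printed for normal matrices: after the unitary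
substitution `η = Uz` the integral is `∏ᵢ ∫_ℂ e^{−λᵢ|w|²} dw`, and a factor with `λᵢ ≤ 0` diverges.
[cite: FinkenrathKnechtliLeder2013OneFlavor, §2.1 eq. (2.1) with the sentence following it, and
App. A (Hermitian remark)]; [cite: LederFinkenrathKnechtli2014, §2 eqs. (2.1), (2.3)] -/
theorem integrable_exp_neg_quadForm_iff (hB : B.IsHermitian) :
    Integrable (fun η : ι → ℂ => Real.exp (-(star η ⬝ᵥ (B *ᵥ η)).re)) ↔ B.PosDef := by
  constructor
  · intro hint
    by_contra hnot
    obtain ⟨i, hi⟩ : ∃ i, hB.eigenvalues i ≤ 0 := by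
      obtain ⟨i, hi⟩ := not_forall.mp (mt hB.posDef_iff_eigenvalues_pos.mpr hnot)
      exact ⟨i, not_lt.mp hi⟩
    have hzero : ∫ η : ι → ℂ, Real.exp (-(star η ⬝ᵥ (B *ᵥ η)).re) = 0 := by
      rw [integral_exp_neg_quadForm_eq_prod hB]
      exact Finset.prod_eq_zero (Finset.mem_univ i)
        (integral_undef (not_integrable_exp_neg_mul_sq_norm hi))
    exact (integral_exp_pos hint).ne' hzero
  · intro hpd
    refine Integrable.of_integral_ne_zero ?_
    rw [complexGaussianIntegral_posDef_holds ι B hpd]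
    have hdet : 0 < (B.det).re := (Complex.lt_def.mp hpd.det_pos).1
    positivity

/-! ## The single-noise Gaussian estimator `W_A(η) = e^{−η†(A−I)η}` of `1/det A` -/

variable {A : Matrix ι ι ℂ}

/-- **The second-moment integrand.**  With Gaussian noise density `p(η) = e^{−η†η}` (up to `1/πⁿ`)
and the single-noise estimate `W_A(η) = e^{−η†(A−I)η}` of `1/det A`, for EVERY complex matrix `A`:
`p(η) |W_A(η)|² = e^{−Re η†(A + A† − I)η}` — the integrand `e^{−η†(A+A†)η}/p(η)²` of the first term of
Finkenrath–Knechtli–Leder's variance formula, weighted by `p`.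
[cite: FinkenrathKnechtliLeder2013OneFlavor, §2.1 eqs. (2.2)–(2.3)] -/
theorem gaussian_mul_sq_norm_detInvEst (A : Matrix ι ι ℂ) (η : ι → ℂ) :
    Real.exp (-(∑ i, ‖η i‖ ^ 2)) * ‖Complex.exp (-(star η ⬝ᵥ ((A - 1) *ᵥ η)))‖ ^ 2 =
      Real.exp (-(star η ⬝ᵥ ((A + Aᴴ - 1) *ᵥ η)).re) := by
  rw [Complex.norm_exp, ← Real.exp_nat_mul, ← Real.exp_add, Complex.neg_re, re_quadForm_sub_one,
    re_quadForm_add_conjTranspose_sub_one]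
  congr 1
  push_cast
  ring

omit [Fintype ι] in
/-- `A + A† − I` is Hermitian for every `A`. [folklore] -/
private theorem isHermitian_add_conjTranspose_sub_one (A : Matrix ι ι ℂ) :
    (A + Aᴴ - 1).IsHermitian :=
  (isHermitian_add_transpose_self A).sub isHermitian_one

/-- **Existence of the variance — Finkenrath–Knechtli–Leder (2.4), for every complex `A`.**  The
second moment `⟨|W_A|²⟩_p = ∫D[η] p(η)|W_A(η)|²` of the single-noise Gaussian estimate of `1/det A` is an
absolutely convergent integral if and only if the Hermitian matrix `A + A† − I` is positive definite
("The first integral in Eq. (2.3) exists if `λ(A+A†−I) > 0 ⟺ λ(A+A†) > 1`"; PoS: "Therefore the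
variance exists iff `σ(A+A†) > 1`").  The "only if" is the divergence of a Gaussian integral with a
non-positive eigen-direction (`integrable_exp_neg_quadForm_iff`).
[cite: FinkenrathKnechtliLeder2013OneFlavor, §2.1 eq. (2.4)];
[cite: LederFinkenrathKnechtli2014, §3, sentence after eq. (3.2)] -/
theorem integrable_gaussian_mul_sq_norm_detInvEst_iff (A : Matrix ι ι ℂ) :
    Integrable (fun η : ι → ℂ =>
        Real.exp (-(∑ i, ‖η i‖ ^ 2)) * ‖Complex.exp (-(star η ⬝ᵥ ((A - 1) *ᵥ η)))‖ ^ 2) ↔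
      (A + Aᴴ - 1).PosDef := by
  simp_rw [gaussian_mul_sq_norm_detInvEst]
  exact integrable_exp_neg_quadForm_iff (isHermitian_add_conjTranspose_sub_one A)

/-- **The second moment — first term of Finkenrath–Knechtli–Leder (2.3), for every complex `A`.**
If `A + A† − I` is positive definite then `⟨|W_A|²⟩_p = 1/det(A + A† − I)`; here without the `1/πⁿ`
of `D[η]`: `∫ e^{−|η|²}|W_A(η)|² dη = πⁿ/det(A + A† − I)` (the determinant of the positive-definite
Hermitian matrix is real and positive; stated through `.re`).
[cite: FinkenrathKnechtliLeder2013OneFlavor, §2.1 eq. (2.3), first term];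
[cite: LederFinkenrathKnechtli2014, §3 eq. (3.2)] -/
theorem integral_gaussian_mul_sq_norm_detInvEst (A : Matrix ι ι ℂ) (h : (A + Aᴴ - 1).PosDef) :
    ∫ η : ι → ℂ, Real.exp (-(∑ i, ‖η i‖ ^ 2)) * ‖Complex.exp (-(star η ⬝ᵥ ((A - 1) *ᵥ η)))‖ ^ 2 =
      Real.pi ^ Fintype.card ι / ((A + Aᴴ - 1).det).re := by
  simp_rw [gaussian_mul_sq_norm_detInvEst]
  exact complexGaussianIntegral_posDef_holds ι _ h

/-! ## The spectral reading `Re λ(A) > 1/2` -/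

/-- **(2.4), last implication: `λ(A + A†) > 1 ⟹ Re λ(A) > 1/2`.**  If `A + A† − I` is positive
definite then every eigenvalue `μ` of `A` has real part `> 1/2` (App. A: at a unit eigenvector `v`,
`v†(A + A†)v = 2 Re(v†Av) = 2 Re μ`).  The converse fails for non-normal `A` ("the two conditions are
only equivalent for normal matrices").
[cite: FinkenrathKnechtliLeder2013OneFlavor, §2.1 eq. (2.4) and App. A (proof via the field of
values, eqs. (A.7)–(A.9))] -/
theorem half_lt_re_eigenvalue (A : Matrix ι ι ℂ) (h : (A + Aᴴ - 1).PosDef) {μ : ℂ} {v : ι → ℂ}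
    (hv : v ≠ 0) (hAv : A *ᵥ v = μ • v) : 1 / 2 < μ.re := by
  have hpos : 0 < (star v ⬝ᵥ ((A + Aᴴ - 1) *ᵥ v)).re :=
    (Complex.lt_def.mp (h.dotProduct_mulVec_pos hv)).1
  rw [re_quadForm_add_conjTranspose_sub_one, hAv, dotProduct_smul, smul_eq_mul, Complex.mul_re,
    re_star_dotProduct_self, im_star_dotProduct_self, mul_zero, sub_zero] at hpos
  have hvv : 0 < ∑ i, ‖v i‖ ^ 2 := by
    obtain ⟨i, hi⟩ := Function.ne_iff.mp hv
    exact lt_of_lt_of_le (by positivity : 0 < ‖v i‖ ^ 2)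
      (Finset.single_le_sum (fun j _ => sq_nonneg ‖v j‖) (Finset.mem_univ i))
  nlinarith
/-! ## Hermitian positive-definite `A`: mean and variance in closed form -/

/-- **The mean — (2.1)/(2.2), Hermitian case: `⟨W_A⟩_p = 1/det A`.**  For Hermitian positive-definite
`A` the estimate `W_A(η) = e^{−η†(A−I)η}` is real (`= e^{−Re η†(A−I)η}`) and
`∫ e^{−|η|²} W_A(η) dη = ∫ e^{−Re η†Aη} dη = πⁿ/det A` (the tree's Altland–Simons integral; at
`A = M†M` this is Knechtli–Wolff (4.5), tree `Pseudofermion.stochasticRatio_mean`).  The general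
non-normal case of (2.1)/(2.2) is `integral_cexp_neg_quadForm` / `integral_gaussian_mul_detInvEst'`
of the sequel `StochasticDeterminantNonNormal.lean`.
[cite: FinkenrathKnechtliLeder2013OneFlavor, §2.1 eqs. (2.1)–(2.2) (Hermitian case)];
[cite: AltlandSimons2010, §3.2 eq. (3.17)] -/
theorem integral_gaussian_mul_detInvEst (hA : A.PosDef) :
    ∫ η : ι → ℂ, Real.exp (-(∑ i, ‖η i‖ ^ 2)) * Real.exp (-(star η ⬝ᵥ ((A - 1) *ᵥ η)).re) =
      Real.pi ^ Fintype.card ι / (A.det).re := by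
  have h : ∀ η : ι → ℂ, Real.exp (-(∑ i, ‖η i‖ ^ 2)) * Real.exp (-(star η ⬝ᵥ ((A - 1) *ᵥ η)).re)
      = Real.exp (-(star η ⬝ᵥ (A *ᵥ η)).re) := by
    intro η
    rw [← Real.exp_add, re_quadForm_sub_one]
    ring_nf
  simp_rw [h]
  exact complexGaussianIntegral_posDef_holds ι A hA
-- General (non-normal) `A` with `λ(A + A†) > 0`: see the sequel `StochasticDeterminantNonNormal.lean`
-- (`integral_cexp_neg_quadForm`, `integral_gaussian_mul_detInvEst'`, `variance_detInvEst'`), proved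
-- there by a ∗-congruence normal form instead of the Schur decomposition / variables `r, s` of App. A.

/-- The determinant of a positive-definite complex matrix is a positive real number. [folklore] -/
private theorem exists_det_eq_ofReal_pos {P : Matrix ι ι ℂ} (hP : P.PosDef) :
    ∃ c : ℝ, 0 < c ∧ P.det = c := by
  refine ⟨(P.det).re, (Complex.lt_def.mp hP.det_pos).1, Complex.ext (by simp) ?_⟩
  have := (Complex.lt_def.mp hP.det_pos).2
  simpa using this.symm

/-- **The variance — Finkenrath–Knechtli–Leder (2.3), Hermitian case.**  For Hermitian
positive-definite `A` with `A + A† − I` (`= 2A − I`) positive definite, the normalised moments of the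
single-noise estimate `W_A(η) = e^{−η†(A−I)η}` (real and positive here: `|W_A|² = W_A²`,
`W_A = e^{−Re η†(A−I)η}`; `D[η] = dη/πⁿ`) satisfy
`σ_η² = ⟨|W_A|²⟩_p − ⟨W_A⟩_p² = 1/det(A + A† − I) − 1/det(AA†)`, where `det(AA†) = (det A)²`.
[cite: FinkenrathKnechtliLeder2013OneFlavor, §2.1 eq. (2.3)];
[cite: LederFinkenrathKnechtli2014, §3 eq. (3.2)] -/
theorem variance_detInvEst (hA : A.PosDef) (h2 : (A + Aᴴ - 1).PosDef) :
    (Real.pi ^ Fintype.card ι)⁻¹ *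
        (∫ η : ι → ℂ, Real.exp (-(∑ i, ‖η i‖ ^ 2)) * ‖Complex.exp (-(star η ⬝ᵥ ((A - 1) *ᵥ η)))‖ ^ 2)
      - ((Real.pi ^ Fintype.card ι)⁻¹ *
        ∫ η : ι → ℂ, Real.exp (-(∑ i, ‖η i‖ ^ 2)) * Real.exp (-(star η ⬝ᵥ ((A - 1) *ᵥ η)).re)) ^ 2
      = 1 / ((A + Aᴴ - 1).det).re - 1 / ((A * Aᴴ).det).re := by
  obtain ⟨a, ha, hda⟩ := exists_det_eq_ofReal_pos hA
  rw [integral_gaussian_mul_sq_norm_detInvEst A h2, integral_gaussian_mul_detInvEst hA, det_mul,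
    det_conjTranspose, hda, Complex.star_def, Complex.conj_ofReal, Complex.ofReal_re]
  have e1 : ((a : ℂ) * a).re = a * a := by rw [← Complex.ofReal_mul, Complex.ofReal_re]
  rw [e1]
  have hpi : Real.pi ^ Fintype.card ι ≠ 0 := pow_ne_zero _ Real.pi_pos.ne'
  have hs : ((A + Aᴴ - 1).det).re ≠ 0 := (Complex.lt_def.mp h2.det_pos).1.ne'
  field_simp

/-! ## (2.5): the relative variance as one determinant -/

/-- **The matrix identity behind (2.5), for every complex `A`**: since
`AA† = (A + A† − I) + (A − I)(A − I)†`, whenever `A + A† − I` is invertible,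
`det A · det A† / det(A + A† − I) = det(I + (A − I)(A − I)†(A + A† − I)⁻¹)` — with `A = I + εB`
this is Finkenrath–Knechtli–Leder's `det(I + ε² BB†/(I + ε(B + B†)))`.
[cite: FinkenrathKnechtliLeder2013OneFlavor, §2.1 eq. (2.5), first equality (matrix identity behind
it)] -/
theorem det_mul_det_conjTranspose_div (A : Matrix ι ι ℂ) (h : (A + Aᴴ - 1).det ≠ 0) :
    A.det * Aᴴ.det / (A + Aᴴ - 1).det =
      (1 + (A - 1) * (A - 1)ᴴ * (A + Aᴴ - 1)⁻¹).det := by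
  have hkey : A * Aᴴ = (A + Aᴴ - 1) + (A - 1) * (A - 1)ᴴ := by
    rw [conjTranspose_sub, conjTranspose_one]
    noncomm_ring
  have hinv : (A + Aᴴ - 1) * (A + Aᴴ - 1)⁻¹ = 1 := mul_nonsing_inv _ (Ne.isUnit h)
  have : 1 + (A - 1) * (A - 1)ᴴ * (A + Aᴴ - 1)⁻¹ = A * Aᴴ * (A + Aᴴ - 1)⁻¹ := by
    rw [hkey, Matrix.add_mul, hinv]
  rw [this, det_mul, det_mul, det_nonsing_inv, Ring.inverse_eq_inv', div_eq_mul_inv]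

/-- **(2.5), Hermitian case, exact**: for Hermitian positive-definite `A` with `A + A† − I` positive
definite, the relative variance of the single-noise estimate is
`σ_η² / (1/det A)² = det(I + (A − I)(A − I)†(A + A† − I)⁻¹) − 1` (no `O(ε³)` remainder at the
determinant level; the printed `ε² Tr(BB†) + O(ε³)` is its small-`ε` expansion, not formalised).
[cite: FinkenrathKnechtliLeder2013OneFlavor, §2.1 eq. (2.5), first equality] -/
theorem relVariance_detInvEst (hA : A.PosDef) (h2 : (A + Aᴴ - 1).PosDef) :
    (1 / ((A + Aᴴ - 1).det).re - 1 / ((A * Aᴴ).det).re) / (1 / (A.det).re) ^ 2 =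
      ((1 + (A - 1) * (A - 1)ᴴ * (A + Aᴴ - 1)⁻¹).det).re - 1 := by
  obtain ⟨a, ha, hda⟩ := exists_det_eq_ofReal_pos hA
  obtain ⟨s, hs, hds⟩ := exists_det_eq_ofReal_pos h2
  have hs' : (A + Aᴴ - 1).det ≠ 0 := by rw [hds]; exact_mod_cast hs.ne'
  have hid := det_mul_det_conjTranspose_div A hs'
  rw [det_conjTranspose, hda, hds, Complex.star_def, Complex.conj_ofReal] at hid
  rw [det_mul, det_conjTranspose, hda, hds, Complex.star_def, Complex.conj_ofReal, ← hid]
  have e1 : ((a : ℂ) * a).re = a * a := by rw [← Complex.ofReal_mul, Complex.ofReal_re]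
  have e2 : ((a : ℂ) * a / s).re = a * a / s := by
    rw [← Complex.ofReal_mul, ← Complex.ofReal_div, Complex.ofReal_re]
  rw [Complex.ofReal_re, Complex.ofReal_re, e1, e2]
  field_simp

end Literature.MathematicalPhysics.QuantumFieldTheory.StochasticDeterminant
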